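import Literature.MathematicalPhysics.QuantumFieldTheory.Balaban1983to89.WilsonLoopsNotCompleteEvenOrthogonal
import Literature.MathematicalPhysics.QuantumFieldTheory.Balaban1983to89.ClassLoopObservablesNotDenseSO8
import HarnessLib

/-!
# LATTICE FORM OF THE `SO(2m)` CENSUS NEGATIVE, `m ≥ 3`: on `ℤ^{d+2}`, NO family of class-function loop observables —
# Wilson loops in ALL representations, with products — spans the gauge-invariant cylinder observables of an `SO(2m)`
# lattice gauge field (module XIX's density schema fails for every even `N ≥ 6` in every representation at once;
# [Weidner2020] Prop. 4.5, [Larsen1994] Thm 3.12, [Yu2021] Thm 1.1 against the `SO(n)` clause of [Levy2004] Thm 3.1)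

statement-level skeleton of published theorems with citation tags; proofs where landed; nothing here is a claim about
the Yang–Mills mass gap

Cell `lit-balaban`, unit p24 gen 21, file 2 of the own-lane free target (G.5-34(d); no SKELETON row).  Module XIX's
density schema `SpansGaugeInvariantCylinders d 𝒲` ([Levy2004] Thm 3.1 transported to cylinder observables of `ℤ^d`) is
FALSE for the natural-representation Wilson-loop products of `SO(2m)`, `m ≥ 1` (p348765), and FALSE for the class
`classLoopProducts` of ALL class-function loop products of `SO(8)` (p352515, families found by compactness).  File 1 of
this unit (`WilsonLoopsNotCompleteEvenOrthogonal`) gives, for EVERY `m ≥ 3`, Weidner's explicit commuting pair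
`D₁, D₂ ∈ SO(2m)` whose subgroup is element-wise but not simultaneously conjugate to its reflection twist.  THIS FILE
draws the lattice consequence for every even `N ≥ 6`:

* §1 the two TEST CONFIGURATIONS on `ℤ^{d+2}`: `D₁`, `D₂` (resp. `P D₁ P`, `P D₂ P`) on the loaded edges
  `e_k = ((2k+1)·𝐞₁, direction 0)`, `k = 0, 1` (p352515's `loadedEdge`, `loopAt`), `1` elsewhere (`cfg`); the holonomy of
  the based rectangle `ℓ_k` is the `k`-th letter (`walkHolonomy_loopAt`); the twisted configuration is the pointwise
  image under `reflConj` (`cfg_genW`);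
* §2 EVERY loop holonomy of the twisted configuration is `SO(2m)`-conjugate to that of the untwisted one (holonomies lie
  in the subgroup generated by the edge values; file 1's `exists_conj_of_mem_closure`), so every element of the SPAN of
  `classLoopProducts (d+2) SO(2m)` — all finite products of `U ↦ f(hol_ℓ(U))`, `f` ANY class function, `ℓ` any based
  loop; it contains `wilsonLoopProducts ρ` for every `ρ` — takes the same value on the two (`eq_on_cfg_of_mem_span`);
* §3 the SEPARATING OBSERVABLE `F(U) = p̃f(H₀(1 − H₀²) + H₁(1 + H₀²))`, `H_k = hol_{ℓ_k}(U)`, `p̃f(X) = pf(X − Xᵀ)` the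
  Pfaffian of the skew part ([AslaksenTanZhu1995] §1; p340120): a gauge-invariant (`p̃f(gXgᵀ) = det g · p̃f(X)` and
  conjugation is a ring homomorphism), continuous, bounded cylinder observable with `F = p̃f(2J) = c ≠ 0` at the
  untwisted and `F = det P · c = −c` at the twisted configuration (file 1's `2J = D₁(1 − D₁²) + D₂(1 + D₁²)`);
* §4 HEADLINE **`not_spansGaugeInvariantCylinders_classLoopProducts`: for every `m ≥ 3` and every `d`,
  `¬ SpansGaugeInvariantCylinders (d+2) (classLoopProducts (d+2) SO(2m))`**, hence for every sub-class (all Wilson loops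
  of any set of representations with products, `…_of_subset_classLoopProducts`), in particular
  `¬ SpansGaugeInvariantCylinders (d+2) (wilsonLoopProducts ρ (d+2))` for EVERY `ρ : SO(2m) →* M_K(ℂ)`; and the
  `SO(N)`, `N` even `≥ 6`, forms.  With p348765 (natural `ρ`, all `m ≥ 1`) and p352515 (`SO(8)`) this closes the even
  orthogonal column of the lineage's density census except `SO(4)` (acceptable in print, [Yu2021] Thm 1.1 — there the
  class-function loop products DO separate gauge orbits of configurations; density on `ℤ^d` not formalised) and `SO(2)`.

HONEST SCOPE.  `SO(2m)`, `m ≥ 3` only; lattice `ℤ^{d+2}` (two directions used); a statement about the observable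
algebra (as modules XX/XXII/XXIII), nothing about torus states, the Wilson action or the infinite-volume question.  What
this says about print: the `SO(n)` clause of [Levy2004] Thm 3.1 (Wilson loops of all representations generate a dense
subalgebra) fails on `ℤ^{d+2}` for every even `n ≥ 6` (HOME/GAPS.md G-p24-g20-1, extended by G-p24-g21-1), consistently
with [Larsen1994] Thm 3.12 / [Weidner2020] Prop. 4.5 / [Yu2021] Thm 1.1; NOT summit progress.

## References

* [Weidner2020] M. Weidner, Transform. Groups 25 (2020) 1345–1370 (arXiv:1809.03644 numbering), §4.3 and Prop. 4.5.
* [Larsen1994] M. Larsen, Israel J. Math. 88 (1994) 253–277, Prop. 3.8 pp. 270–271, Thm 3.12 p. 276.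
* [Yu2021] J. Yu, Peking Math. J. 5 (2021) 427–446 (arXiv:1806.06316 numbering), Thm 1.1, Example 4.1.
* [Levy2004] T. Lévy, J. Geom. Phys. 52 (2004) 382–397: §2 p.4, Remark 2.4, Thm 3.1 p.5 (the `SO(n)` clause), Prop. 3.6.
* [AslaksenTanZhu1995] H. Aslaksen, E.-C. Tan, C.-B. Zhu, Pacific J. Math. 168 (1995) §1 p.207 (`p̃f`, «clearly an
  SO(2k, F) invariant»).
-/

noncomputable section

open Matrix SimpleGraph
open scoped Matrix

namespace Literature.MathematicalPhysics.QuantumFieldTheory.Balaban1983to89.ClassLoopObservablesNotDenseEvenOrthogonal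

open Literature.MathematicalPhysics.QuantumLattice
open Literature.Probability.LatticeModels (zdGraph)
open Balaban1983to89.Missing (SpansGaugeInvariantCylinders)
open Literature.LinearAlgebra.Matrix (pfaffian pfaffian_fin_add_two det_eq_pfaffian_sq)
open TraceWordsSeparateOrbitsEvenOrthogonal (realJ negAt pfaffianSkew_conj star_negAt det_negAt negAt_mul_negAt
  det_realJ realJ_transpose)
open WilsonLoopProductsNotDenseEvenOrthogonal (reflConj coe_reflConj walkHolonomy_monoidHom)
open WilsonLoopsNotCompleteEvenOrthogonal (SO2 Φ uGen genV genW coe_genV genW_eq genV_poly conjHom conjHom_apply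
  exists_conj_of_mem_closure)
open ClassLoopObservablesNotDenseSO8 (classLoopProducts wilsonLoopProducts_subset_classLoopProducts
  eq_of_mem_classLoopProducts walkHolonomy_eq_wordVal walkHolonomy_gaugeTransformZd loadedEdge loopAt sepSupport)

/-! ## §1 The two test configurations of `SO(2m)` on `ℤ^{d+2}` -/

section Configurations

variable {d : ℕ} {G : Type*} [Group G]

/-- A straight walk in a direction along which the configuration is trivial has trivial holonomy. [folklore] -/
private theorem walkHolonomy_lineWalk_eq_one {U : LGConfig d G} {i : Fin d} (hU : ∀ z : (Fin d → ℤ), U (z, i) = 1) :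
    ∀ (n : ℕ) (x : (Fin d → ℤ)), walkHolonomy U (lineWalk i n x) = 1
  | 0, x => by simp [lineWalk]
  | n + 1, x => by
    rw [lineWalk, walkHolonomy_cons, walkHolonomy_copy, dartHolonomy_add_single, hU, one_mul,
      walkHolonomy_lineWalk_eq_one hU n]

/-- The holonomy of a rectangle is the product of its four sides. [folklore] -/
private theorem walkHolonomy_rectWalk (U : LGConfig d G) (x : (Fin d → ℤ)) (i j : Fin d) (R T : ℕ) :
    walkHolonomy U (rectWalk x i j R T) =
      walkHolonomy U (lineWalk i R x) * walkHolonomy U (lineWalk j T (x + Pi.single i (R : ℤ))) *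
        (walkHolonomy U (lineWalk i R (x + Pi.single j (T : ℤ))))⁻¹ * (walkHolonomy U (lineWalk j T x))⁻¹ := by
  simp only [rectWalk, walkHolonomy_append, walkHolonomy_copy, walkHolonomy_reverse, mul_assoc]

/-- The two loaded edges `e_0 = (𝐞₁, 0)`, `e_1 = (3𝐞₁, 0)` are distinct: `k ↦ e_k` is injective on `Fin 2`. [folklore] -/
private theorem loadedEdge_fin_injective : Function.Injective fun k : Fin 2 => loadedEdge d k := by
  intro k l h
  have h1 := congrArg (fun e : ZdEdge (d + 2) => e.1 1) h
  simp only [loadedEdge, Pi.single_eq_same] at h1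
  exact Fin.ext (by omega)

variable (d)

/-- **THE TEST CONFIGURATION** attached to a two-letter family `V : Fin 2 → G`: `V k` on the loaded edge
`e_k = ((2k+1)·𝐞₁, direction 0)` (`k = 0, 1`), `1` elsewhere — a lattice gauge field on `ℤ^{d+2}` realising the bouquet
`L₂` with two based rectangles. [cite: Levy2004, §2 p.4 and Prop 3.6 (graphs L_r); Weidner2020, §4.3 (Γ = ℤ/4 × ℤ/4 on two generators)] -/
def cfg (V : Fin 2 → G) : LGConfig (d + 2) G := Function.extend (fun k : Fin 2 => loadedEdge d k) V 1

variable {d}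

/-- On the loaded edge `e_k` the configuration is `V k`. [folklore] -/
private theorem cfg_loadedEdge (V : Fin 2 → G) (k : Fin 2) : cfg d V (loadedEdge d k) = V k :=
  loadedEdge_fin_injective.extend_apply _ _ k

/-- Off direction `0` the configuration is `1`. [folklore] -/
private theorem cfg_of_snd_ne (V : Fin 2 → G) {e : ZdEdge (d + 2)} (he : e.2 ≠ 0) : cfg d V e = 1 := by
  rw [cfg, Function.extend_apply']
  · rfl
  · rintro ⟨k, hk⟩
    exact he (by rw [← hk]; rfl)

/-- The edge at the origin in direction `0` is unloaded. [folklore] -/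
private theorem cfg_origin (V : Fin 2 → G) : cfg d V ((0 : (Fin (d + 2) → ℤ)), (0 : Fin (d + 2))) = 1 := by
  rw [cfg, Function.extend_apply']
  · rfl
  · rintro ⟨k, hk⟩
    have h1 : ((2 * (k : ℕ) + 1 : ℕ) : ℤ) = 0 := by
      simpa [loadedEdge] using congrArg (fun e : ZdEdge (d + 2) => e.1 1) hk
    omega

/-- The values of the test configuration are letters or `1`. [folklore] -/
private theorem cfg_mem_closure (V : Fin 2 → G) (e : ZdEdge (d + 2)) : cfg d V e ∈ Subgroup.closure (Set.range V) := by
  rw [cfg]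
  by_cases h : ∃ k : Fin 2, loadedEdge d k = e
  · obtain ⟨k, rfl⟩ := h
    rw [loadedEdge_fin_injective.extend_apply]
    exact Subgroup.subset_closure ⟨k, rfl⟩
  · rw [Function.extend_apply' _ _ _ h]
    exact one_mem _

/-- `(1 : Fin (d+2)) ≠ 0`. [folklore] -/
private theorem one_ne_zero_fin : (1 : Fin (d + 2)) ≠ 0 := by simp

/-- **HOLONOMY OF THE BASED RECTANGLE `ℓ_k` AT THE TEST CONFIGURATION = THE `k`-TH LETTER** (the three other loaded-direction
edges of `ℓ_k` are unloaded). [cite: Levy2004, §2 p.4 (h_l as the ordered product of edge variables)] -/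
theorem walkHolonomy_loopAt (V : Fin 2 → G) (k : Fin 2) : walkHolonomy (cfg d V) (loopAt d k) = V k := by
  have h1 : ∀ z : (Fin (d + 2) → ℤ), cfg d V (z, 1) = 1 := fun z => cfg_of_snd_ne V (e := (z, 1)) one_ne_zero_fin
  rw [loopAt, walkHolonomy_rectWalk, walkHolonomy_lineWalk_eq_one h1, walkHolonomy_lineWalk_eq_one h1,
    walkHolonomy_lineWalk_one, walkHolonomy_lineWalk_one, zero_add, cfg_origin, inv_one, one_mul, mul_one, mul_one]
  exact cfg_loadedEdge V k

/-- `hol_{ℓ₀} = V 0` at the test configuration. [cite: Levy2004, §2 p.4] -/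
theorem walkHolonomy_loopAt_zero (V : Fin 2 → G) : walkHolonomy (cfg d V) (loopAt d 0) = V 0 := by
  have h := walkHolonomy_loopAt (d := d) V 0
  change walkHolonomy (cfg d V) (loopAt d 0) = V 0 at h
  exact h

/-- `hol_{ℓ₁} = V 1` at the test configuration. [cite: Levy2004, §2 p.4] -/
theorem walkHolonomy_loopAt_one (V : Fin 2 → G) : walkHolonomy (cfg d V) (loopAt d 1) = V 1 := by
  have h := walkHolonomy_loopAt (d := d) V 1
  change walkHolonomy (cfg d V) (loopAt d 1) = V 1 at h
  exact h

/-- **EVERY LOOP HOLONOMY OF THE TEST CONFIGURATION LIES IN THE SUBGROUP GENERATED BY THE LETTERS** (a holonomy is a word in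
the edge variables). [cite: Levy2004, §2 p.4] -/
theorem walkHolonomy_cfg_mem_closure (V : Fin 2 → G) {x y : (Fin (d + 2) → ℤ)} (w : (zdGraph (d + 2)).Walk x y) :
    walkHolonomy (cfg d V) w ∈ Subgroup.closure (Set.range V) := by
  rw [walkHolonomy_eq_wordVal]
  refine (Subgroup.closure_le _).2 ?_ (WilsonLoopsNotCompleteEvenOrthogonal.wordVal_mem_closure _ (cfg d V))
  rintro _ ⟨e, rfl⟩
  exact cfg_mem_closure V e

/-- A homomorphism applied pointwise to the test configuration of `V` gives the test configuration of `φ ∘ V`. [folklore] -/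
private theorem cfg_comp_hom {H : Type*} [Group H] (φ : G →* H) (V : Fin 2 → G) :
    cfg d (φ ∘ V) = fun e => φ (cfg d V e) := by
  funext e
  rw [cfg, cfg, Function.apply_extend φ]
  congr 1
  funext x
  exact (map_one φ).symm

variable (m : ℕ) (d)

/-- **THE TWISTED TEST CONFIGURATION IS THE POINTWISE REFLECTION TWIST OF THE UNTWISTED ONE**: `cfg (genW i₀) = P · cfg (genV) · P`
edge by edge (Weidner's `ρ' = XρX⁻¹` read on the lattice; p348765's `reflConj`). [cite: Weidner2020, Prop 4.4 («ρ' = XρX⁻¹»)] -/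
theorem cfg_genW (i₀ : Fin (m + m)) : cfg d (genW m i₀) = fun e => reflConj m i₀ (cfg d (genV m) e) := by
  rw [genW_eq, cfg_comp_hom]

end Configurations

/-! ## §2 Every loop holonomy of the twisted configuration is conjugate; class-loop products cannot tell them apart -/

section Blind

variable (m : ℕ) {d : ℕ}

/-- **EVERY LOOP HOLONOMY OF THE TWISTED CONFIGURATION IS `SO(2m)`-CONJUGATE TO THAT OF THE UNTWISTED ONE** (`m ≥ 3`; any
walk, closed or not): the holonomy lies in `⟨D₁, D₂⟩`, on which the twist is inner element by element (file 1).
[cite: Weidner2020, Prop 4.5; Levy2004, Prop 3.4 (hypothesis)] -/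
theorem exists_walkHolonomy_conj (hm : 3 ≤ m) (i₀ : Fin (m + m)) {x y : (Fin (d + 2) → ℤ)}
    (w : (zdGraph (d + 2)).Walk x y) :
    ∃ g : SO2 m, walkHolonomy (cfg d (genW m i₀)) w = g * walkHolonomy (cfg d (genV m)) w * g⁻¹ := by
  rw [cfg_genW, walkHolonomy_monoidHom]
  exact exists_conj_of_mem_closure m hm i₀ (walkHolonomy_cfg_mem_closure (genV m) w)

/-- Hence EVERY CLASS-LOOP PRODUCT takes the same value on the two test configurations. [cite: Weidner2020, Prop 4.5; Levy2004, §2 p.4] -/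
theorem eq_on_cfg (hm : 3 ≤ m) (i₀ : Fin (m + m)) {W : LGConfig (d + 2) (SO2 m) → ℝ}
    (hW : W ∈ classLoopProducts (d + 2) (SO2 m)) : W (cfg d (genV m)) = W (cfg d (genW m i₀)) :=
  eq_of_mem_classLoopProducts hW fun _ w => exists_walkHolonomy_conj m hm i₀ w

/-- … and so does every element of their REAL SPAN. [cite: Levy2004, Thm 3.1 p.5 (the algebra generated by Wilson loops)] -/
theorem eq_on_cfg_of_mem_span (hm : 3 ≤ m) (i₀ : Fin (m + m)) {W : LGConfig (d + 2) (SO2 m) → ℝ}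
    (hW : W ∈ Submodule.span ℝ (classLoopProducts (d + 2) (SO2 m))) : W (cfg d (genV m)) = W (cfg d (genW m i₀)) := by
  induction hW using Submodule.span_induction with
  | mem w hw => exact eq_on_cfg m hm i₀ hw
  | zero => rfl
  | add w₁ w₂ _ _ h₁ h₂ => simp [h₁, h₂]
  | smul c w _ h => simp [h]

end Blind

/-! ## §3 The separating observable: the Pfaffian of the skew part of `H₀(1 − H₀²) + H₁(1 + H₀²)` -/

section Separating

variable (m : ℕ)

/-- For a real matrix `star = transpose`. [folklore] -/
private theorem star_eq_transpose' {n : Type*} [Fintype n] (A : Matrix n n ℝ) : star A = Aᵀ := by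
  rw [Matrix.star_eq_conjTranspose, Matrix.conjTranspose_eq_transpose_of_trivial]

/-- The Pfaffian is continuous (a polynomial in the entries; induction over the Laplace-type expansion). [folklore] -/
private theorem continuous_pfaffian : ∀ {n : ℕ}, Continuous fun A : Matrix (Fin n) (Fin n) ℝ => pfaffian A
  | 0 => continuous_const
  | 1 => continuous_const
  | n + 2 => by
      have ih : Continuous fun A : Matrix (Fin n) (Fin n) ℝ => pfaffian A := continuous_pfaffian
      simp only [pfaffian_fin_add_two]
      refine continuous_finsetSum _ fun j _ => ?_
      refine (continuous_const.mul (continuous_id.matrix_elem 0 j.succ)).mul ?_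
      exact ih.comp (continuous_id.matrix_submatrix _ _)

/-- **THE POLYNOMIAL `q(X, Y) = X(1 − X²) + Y(1 + X²)`** — at Weidner's generators it equals `2J` (file 1, `genV_poly`).
[folklore] -/
def qPoly (X Y : Matrix (Fin (m + m)) (Fin (m + m)) ℝ) : Matrix (Fin (m + m)) (Fin (m + m)) ℝ :=
  X * (1 - X ^ 2) + Y * (1 + X ^ 2)

/-- A ring homomorphism commutes with `q`. [folklore] -/
private theorem map_qPoly (f : Matrix (Fin (m + m)) (Fin (m + m)) ℝ →+* Matrix (Fin (m + m)) (Fin (m + m)) ℝ)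
    (X Y : Matrix (Fin (m + m)) (Fin (m + m)) ℝ) : f (qPoly m X Y) = qPoly m (f X) (f Y) := by
  simp only [qPoly, map_add, map_mul, map_sub, map_pow, map_one]

/-- **THE PFAFFIAN OF THE SKEW PART `p̃f(X) = pf(X − Xᵀ)`** ([AslaksenTanZhu1995] §1; p340120). [cite: AslaksenTanZhu1995, §1 p.207] -/
def pfSkew (X : Matrix (Fin (m + m)) (Fin (m + m)) ℝ) : ℝ := pfaffian (X - Xᵀ)

/-- `p̃f` is continuous. [folklore] -/
private theorem continuous_pfSkew : Continuous (pfSkew m) :=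
  continuous_pfaffian.comp (continuous_id.sub continuous_id.matrix_transpose)

/-- `p̃f(X) ≠ 0` as soon as `det(X − Xᵀ) ≠ 0` (`det = pf²` on skew matrices with zero diagonal — tree's
`det_eq_pfaffian_sq`, Cayley). [cite: AslaksenTanZhu1995, §1 p.207 («det A = pf² A»)] -/
theorem pfSkew_ne_zero_of_det_ne_zero {X : Matrix (Fin (m + m)) (Fin (m + m)) ℝ} (h : (X - Xᵀ).det ≠ 0) :
    pfSkew m X ≠ 0 := by
  have hskew : (X - Xᵀ)ᵀ = -(X - Xᵀ) := by rw [Matrix.transpose_sub, Matrix.transpose_transpose, neg_sub]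
  have hdiag : ∀ i, (X - Xᵀ) i i = 0 := fun i => by simp
  rw [det_eq_pfaffian_sq _ hskew hdiag] at h
  intro h0
  rw [pfSkew] at h0
  rw [h0] at h
  exact h (by ring)

/-- **`c := p̃f(2J) ≠ 0`**: `2J − (2J)ᵀ = 4J` and `det(4J) = 4^{2m} ≠ 0`. [cite: AslaksenTanZhu1995, §1 p.207] -/
theorem pfSkew_two_smul_realJ_ne_zero : pfSkew m ((2 : ℝ) • realJ m) ≠ 0 := by
  refine pfSkew_ne_zero_of_det_ne_zero m ?_
  have h4 : (2 : ℝ) • realJ m - ((2 : ℝ) • realJ m)ᵀ = (4 : ℝ) • realJ m := by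
    rw [Matrix.transpose_smul, realJ_transpose, smul_neg, sub_neg_eq_add, ← add_smul]; norm_num
  rw [h4, Matrix.det_smul, det_realJ, mul_one, Fintype.card_fin]
  exact pow_ne_zero _ (by norm_num)

variable (d : ℕ)

/-- **THE SEPARATING OBSERVABLE** `F(U) = p̃f(q(hol_{ℓ₀}(U), hol_{ℓ₁}(U)))`, the two based rectangles `ℓ₀, ℓ₁` at the origin
(a function of several holonomies of loops based at the same point, invariant under diagonal conjugation by `SO(2m)` —
the shape of [Levy2004] Remark 2.4; the invariant `p̃f` of [AslaksenTanZhu1995]). [cite: Levy2004, Remark 2.4; AslaksenTanZhu1995, §1 p.207] -/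
def sepObs (U : LGConfig (d + 2) (SO2 m)) : ℝ :=
  pfSkew m (qPoly m ((walkHolonomy U (loopAt d 0) : SO2 m) : Matrix (Fin (m + m)) (Fin (m + m)) ℝ)
    ((walkHolonomy U (loopAt d 1) : SO2 m) : Matrix (Fin (m + m)) (Fin (m + m)) ℝ))

variable {m d}

/-- `F` is a CYLINDER on the edges under the two rectangles. [folklore] -/
private theorem isCylinder_sepObs : IsCylinder (sepObs m d) (sepSupport d 2) := by
  intro U U' hUU'
  have hk : ∀ k : Fin 2, walkHolonomy U (loopAt d k) = walkHolonomy U' (loopAt d k) := fun k => by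
    refine walkHolonomy_congr _ fun e he => hUU' _ ?_
    simp only [sepSupport, Finset.coe_biUnion, Finset.coe_univ, Set.mem_univ, Set.iUnion_true, Set.mem_iUnion,
      List.coe_toFinset, Set.mem_setOf_eq, List.mem_map]
    exact ⟨k, e, he, rfl⟩
  have h0 := hk 0
  have h1 := hk 1
  change walkHolonomy U (loopAt d 0) = walkHolonomy U' (loopAt d 0) at h0
  change walkHolonomy U (loopAt d 1) = walkHolonomy U' (loopAt d 1) at h1
  unfold sepObs
  rw [h0, h1]

/-- `F` is CONTINUOUS. [folklore] -/
private theorem continuous_sepObs : Continuous (sepObs m d) := by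
  have h0 : Continuous fun U : LGConfig (d + 2) (SO2 m) =>
      ((walkHolonomy U (loopAt d 0) : SO2 m) : Matrix (Fin (m + m)) (Fin (m + m)) ℝ) :=
    continuous_subtype_val.comp (continuous_walkHolonomy _)
  have h1 : Continuous fun U : LGConfig (d + 2) (SO2 m) =>
      ((walkHolonomy U (loopAt d 1) : SO2 m) : Matrix (Fin (m + m)) (Fin (m + m)) ℝ) :=
    continuous_subtype_val.comp (continuous_walkHolonomy _)
  unfold sepObs qPoly
  exact (continuous_pfSkew m).comp
    ((h0.mul (continuous_const.sub (h0.pow 2))).add (h1.mul (continuous_const.add (h0.pow 2))))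

/-- `F` is BOUNDED (continuous on the compact configuration space). [folklore] -/
private theorem exists_bound_sepObs : ∃ C : ℝ, ∀ U, |sepObs m d U| ≤ C := by
  have hc := (continuous_sepObs (m := m) (d := d)).abs.continuousOn (s := Set.univ)
  obtain ⟨U₀, -, hU₀⟩ :=
    (isCompact_univ (X := LGConfig (d + 2) (SO2 m))).exists_isMaxOn Set.univ_nonempty hc
  exact ⟨|sepObs m d U₀|, fun U => hU₀ (Set.mem_univ U)⟩

/-- `p̃f ∘ q` is invariant under SIMULTANEOUS conjugation by `SO(2m)` (conjugation by an orthogonal `g` is a ring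
homomorphism, and `p̃f(gXgᵀ) = det g · p̃f(X)`). [cite: AslaksenTanZhu1995, §1 p.207 («pf(gAgᵗ) = det g pf A … clearly an SO(2k, F) invariant»)] -/
theorem pfSkew_qPoly_conj (g X Y : SO2 m) :
    pfSkew m (qPoly m ((g * X * g⁻¹ : SO2 m) : Matrix (Fin (m + m)) (Fin (m + m)) ℝ)
        ((g * Y * g⁻¹ : SO2 m) : Matrix (Fin (m + m)) (Fin (m + m)) ℝ)) =
      pfSkew m (qPoly m (X : Matrix (Fin (m + m)) (Fin (m + m)) ℝ) (Y : Matrix (Fin (m + m)) (Fin (m + m)) ℝ)) := by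
  obtain ⟨hgO, hgdet⟩ := Matrix.mem_specialOrthogonalGroup_iff.1 g.2
  have hg1 : (g : Matrix (Fin (m + m)) (Fin (m + m)) ℝ)ᵀ * g = 1 := by
    have h := Matrix.mem_unitaryGroup_iff'.1 hgO; rwa [star_eq_transpose'] at h
  have hg2 : (g : Matrix (Fin (m + m)) (Fin (m + m)) ℝ) * (g : Matrix (Fin (m + m)) (Fin (m + m)) ℝ)ᵀ = 1 := by
    have h := Matrix.mem_unitaryGroup_iff.1 hgO; rwa [star_eq_transpose'] at h
  have hX : ((g * X * g⁻¹ : SO2 m) : Matrix (Fin (m + m)) (Fin (m + m)) ℝ) = conjHom _ hg1 hg2 X := by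
    rw [conjHom_apply, ← Matrix.star_eq_inv, Submonoid.coe_mul, Submonoid.coe_mul, Matrix.specialUnitaryGroup.coe_star,
      star_eq_transpose']
  have hY : ((g * Y * g⁻¹ : SO2 m) : Matrix (Fin (m + m)) (Fin (m + m)) ℝ) = conjHom _ hg1 hg2 Y := by
    rw [conjHom_apply, ← Matrix.star_eq_inv, Submonoid.coe_mul, Submonoid.coe_mul, Matrix.specialUnitaryGroup.coe_star,
      star_eq_transpose']
  rw [hX, hY, ← map_qPoly, conjHom_apply, pfSkew, pfSkew, ← star_eq_transpose' (g : Matrix (Fin (m + m)) (Fin (m + m)) ℝ),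
    pfaffianSkew_conj, hgdet, one_mul]

/-- **`F` IS GAUGE INVARIANT** (both rectangles are based at the origin, where a gauge transformation conjugates their
holonomies by the same group element). [cite: Levy2004, §2 p.4 and Remark 2.4] -/
theorem isZdGaugeInvariant_sepObs : IsZdGaugeInvariant (sepObs m d) := by
  intro g U
  unfold sepObs
  rw [walkHolonomy_gaugeTransformZd, walkHolonomy_gaugeTransformZd, pfSkew_qPoly_conj]

variable (m d)

/-- **`F = c := p̃f(2J)` AT THE UNTWISTED CONFIGURATION** (`q(D₁, D₂) = 2J`, file 1). [cite: Weidner2020, Prop 4.5; AslaksenTanZhu1995, §1 p.207] -/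
theorem sepObs_cfg_genV : sepObs m d (cfg d (genV m)) = pfSkew m ((2 : ℝ) • realJ m) := by
  rw [sepObs, walkHolonomy_loopAt_zero, walkHolonomy_loopAt_one, coe_genV, coe_genV, qPoly, genV_poly]

/-- **`F = det P · c = −c` AT THE TWISTED CONFIGURATION** (`q(PD₁P, PD₂P) = P(2J)P`, `p̃f(PXPᵀ) = det P · p̃f(X)`, `det P = −1`).
[cite: Weidner2020, Prop 4.4 (pl is odd under X ∈ O_{2n} ∖ SO_{2n}); AslaksenTanZhu1995, §1 p.207] -/
theorem sepObs_cfg_genW (i₀ : Fin (m + m)) : sepObs m d (cfg d (genW m i₀)) = -pfSkew m ((2 : ℝ) • realJ m) := by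
  have hQ1 : (negAt i₀)ᵀ * negAt i₀ = 1 := by rw [← star_eq_transpose', star_negAt, negAt_mul_negAt]
  have hQ2 : negAt i₀ * (negAt i₀)ᵀ = 1 := by rw [← star_eq_transpose', star_negAt, negAt_mul_negAt]
  have hk : ∀ k : Fin 2, ((genW m i₀ k : SO2 m) : Matrix (Fin (m + m)) (Fin (m + m)) ℝ) =
      conjHom _ hQ1 hQ2 (Φ m (uGen m k)) := fun k => by
    rw [genW_eq, Function.comp_apply, coe_reflConj, coe_genV, conjHom_apply, ← star_eq_transpose' (negAt i₀), star_negAt]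
  rw [sepObs, walkHolonomy_loopAt_zero, walkHolonomy_loopAt_one, hk, hk, ← map_qPoly, qPoly, genV_poly, conjHom_apply,
    pfSkew, pfSkew, ← star_eq_transpose' (negAt i₀), pfaffianSkew_conj, det_negAt, neg_one_mul]

end Separating

/-! ## §4 Headline: no class of loop observables spans the gauge-invariant cylinders for `SO(2m)`, `m ≥ 3` -/

section Headline

variable (m : ℕ) {d : ℕ}

/-- **MODULE XIX's DENSITY SCHEMA FAILS FOR `SO(2m)`, `m ≥ 3`, EVEN FOR THE CLASS OF ALL CLASS-FUNCTION LOOP PRODUCTS**: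
for every `d`, the real span of `classLoopProducts (d+2) SO(2m)` — all finite products of `U ↦ f(hol_ℓ(U))`, `f` any
class function, `ℓ` any based loop; in particular all Wilson loops of ALL finite-dimensional representations with their
products — is NOT sup-norm dense in the gauge-invariant continuous bounded cylinder observables of `ℤ^{d+2}`: every
element of the span agrees on the two test configurations, where the gauge-invariant cylinder `F` takes the values
`c ≠ 0` and `−c`. [cite: Levy2004, Thm 3.1 p.5 (SO(n) clause; refuted for even n ≥ 6); Weidner2020, Prop 4.5; Larsen1994, Thm 3.12; Yu2021, Thm 1.1] -/
theorem not_spansGaugeInvariantCylinders_classLoopProducts (hm : 3 ≤ m) (d : ℕ) :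
    ¬ SpansGaugeInvariantCylinders (d + 2) (classLoopProducts (d + 2) (Matrix.specialOrthogonalGroup (Fin (m + m)) ℝ)) := by
  intro h
  obtain ⟨i₀⟩ : Nonempty (Fin (m + m)) := ⟨⟨0, by omega⟩⟩
  set c : ℝ := pfSkew m ((2 : ℝ) • realJ m) with hcdef
  have hc : c ≠ 0 := pfSkew_two_smul_realJ_ne_zero m
  obtain ⟨W, hW, hclose⟩ := h (sepObs m d) _ isCylinder_sepObs continuous_sepObs exists_bound_sepObs
    isZdGaugeInvariant_sepObs (|c| / 2) (by positivity)
  have h1 := hclose (cfg d (genV m))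
  have h2 := hclose (cfg d (genW m i₀))
  rw [sepObs_cfg_genV] at h1
  rw [sepObs_cfg_genW, ← eq_on_cfg_of_mem_span m hm i₀ hW] at h2
  have h3 : |c - (-c)| ≤ |c| / 2 + |c| / 2 := by
    calc |c - (-c)| = |(c - W (cfg d (genV m))) - (-c - W (cfg d (genV m)))| := by ring_nf
      _ ≤ |c - W (cfg d (genV m))| + |(-c) - W (cfg d (genV m))| := abs_sub _ _
      _ ≤ |c| / 2 + |c| / 2 := add_le_add h1 h2
  have h4 : |c - (-c)| = 2 * |c| := by
    rw [sub_neg_eq_add, ← two_mul, abs_mul, abs_two]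
  have h5 : |c| ≤ 0 := by linarith
  exact hc (abs_eq_zero.mp (le_antisymm h5 (abs_nonneg c)))

/-- Hence NO SUB-CLASS spans either: any set of class-function loop products — e.g. the Wilson loops of any set of
representations, with products. [cite: Levy2004, Thm 3.1 p.5 (SO(n) clause; refuted for even n ≥ 6)] -/
theorem not_spansGaugeInvariantCylinders_of_subset_classLoopProducts (hm : 3 ≤ m) (d : ℕ)
    {𝒲 : Set (LGConfig (d + 2) (Matrix.specialOrthogonalGroup (Fin (m + m)) ℝ) → ℝ)}
    (h𝒲 : 𝒲 ⊆ classLoopProducts (d + 2) (Matrix.specialOrthogonalGroup (Fin (m + m)) ℝ)) :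
    ¬ SpansGaugeInvariantCylinders (d + 2) 𝒲 := fun h =>
  not_spansGaugeInvariantCylinders_classLoopProducts m hm d (spansGaugeInvariantCylinders_mono (Submodule.span_mono h𝒲) h)

/-- **In particular for EVERY SINGLE REPRESENTATION `ρ : SO(2m) →* M_K(ℂ)`, `m ≥ 3`** (any `K`, continuity not needed):
`¬ SpansGaugeInvariantCylinders (d+2) (wilsonLoopProducts ρ (d+2))` — p348765 was the natural representation (all
`m ≥ 1`), p352515 every representation of `SO(8)`. [cite: Levy2004, Thm 3.1 p.5 and Abstract p.2; Weidner2020, Prop 4.5; Larsen1994, Thm 3.12] -/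
theorem not_spansGaugeInvariantCylinders_wilsonLoopProducts (hm : 3 ≤ m) (d : ℕ) {K : ℕ}
    (ρ : Matrix.specialOrthogonalGroup (Fin (m + m)) ℝ →* Matrix (Fin K) (Fin K) ℂ) :
    ¬ SpansGaugeInvariantCylinders (d + 2) (wilsonLoopProducts ρ (d + 2)) :=
  not_spansGaugeInvariantCylinders_of_subset_classLoopProducts m hm d (wilsonLoopProducts_subset_classLoopProducts ρ)

/-- **`SO(N)`, `N` EVEN, `N ≥ 6`, every `d ≥ 2`: `¬ SpansGaugeInvariantCylinders (d+2) (classLoopProducts (d+2) SO(N))`.**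
[cite: Levy2004, Thm 3.1 p.5 (SO(n) clause; refuted for even n ≥ 6); Weidner2020, Prop 4.5; Larsen1994, Thm 3.12; Yu2021, Thm 1.1] -/
theorem not_spansGaugeInvariantCylinders_classLoopProducts_even {N : ℕ} (hN : Even N) (h6 : 6 ≤ N) (d : ℕ) :
    ¬ SpansGaugeInvariantCylinders (d + 2) (classLoopProducts (d + 2) (Matrix.specialOrthogonalGroup (Fin N) ℝ)) := by
  obtain ⟨m, rfl⟩ := hN
  exact not_spansGaugeInvariantCylinders_classLoopProducts m (by omega) d

/-- `SO(N)`, `N` even, `N ≥ 6`, every representation `ρ : SO(N) →* M_K(ℂ)`, every `d ≥ 2`: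
`¬ SpansGaugeInvariantCylinders (d+2) (wilsonLoopProducts ρ (d+2))`. [cite: Levy2004, Thm 3.1 p.5 (SO(n) clause; refuted for even n ≥ 6); Weidner2020, Prop 4.5] -/
theorem not_spansGaugeInvariantCylinders_wilsonLoopProducts_even {N : ℕ} (hN : Even N) (h6 : 6 ≤ N) (d : ℕ) {K : ℕ}
    (ρ : Matrix.specialOrthogonalGroup (Fin N) ℝ →* Matrix (Fin K) (Fin K) ℂ) :
    ¬ SpansGaugeInvariantCylinders (d + 2) (wilsonLoopProducts ρ (d + 2)) := by
  obtain ⟨m, rfl⟩ := hN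
  exact not_spansGaugeInvariantCylinders_wilsonLoopProducts m (by omega) d ρ

end Headline

end Literature.MathematicalPhysics.QuantumFieldTheory.Balaban1983to89.ClassLoopObservablesNotDenseEvenOrthogonal
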